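import Summits.CriticalPhenomena.Ising3DConformalLimit.Theses.PerfectScreening
import Summits.CriticalPhenomena.Ising3DConformalLimit.Theses.PlantedPinning
import Summits.CriticalPhenomena.Ising3DConformalLimit.Theses.SubPtolemyInterlacing
import Summits.CriticalPhenomena.Ising3DConformalLimit.Theses.EnergyNotSigmaSquared
import Summits.CriticalPhenomena.Ising3DConformalLimit.Theses.HyperoctahedralRP
import Summits.CriticalPhenomena.Ising3DConformalLimit.Theorems.PlantedPinningMoebiusLimitExistsWardDoor
import Summits.CriticalPhenomena.Ising3DConformalLimit.Theorems.PlantedPinningMoebiusLimitExistsWeakTranslation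
import Summits.CriticalPhenomena.Ising3DConformalLimit.Theorems.PlantedPinningMoebiusLimitExistsWardOnU0
import Summits.CriticalPhenomena.Ising3DConformalLimit.Theorems.PlantedPinningMoebiusLimitExistsWardOfWardOnU0
import Summits.CriticalPhenomena.Ising3DConformalLimit.Theorems.EnergyNotSigmaSquaredMoebiusLimitExistsHrpFactorisation
import Literature.Probability.LatticeModels.SCTWardIdentity
import Literature.MathematicalPhysics.QuantumFieldTheory.PointwiseOSReconstruction
import HarnessLib

/-!
# The Ward door is TIGHT: crux `MoebiusLimitExists` (stmt-CriticalPhenomena-1344) ⟺ item 1981 ∧ 7″, item 1982 ⟺ the Ward upgrade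
(line `Sketch` v9/v10, lead prover-line-stmt-CriticalPhenomena-1344-c16-0; THEOREM-ONLY, `--supports stmt-CriticalPhenomena-1344`)

The converse of the door.  With the three analysis stubs of skeleton v9 landed — F0 `stub_weakTranslation` (strong translation
invariance + continuity ⇒ the weak translation identity), F1 `stub_wardOnU0` (`K = ιPι` at the weak level: inversion covariance on
`U₀ = {∀ i, xᵢ ≠ 0}` + the weak translation identity ⇒ the weak special-conformal Ward identity for `U₀`-supported tests) and F2
`stub_wardOfWardOnU0` (extension to all tests supported off the diagonals by the large-translation polynomial trick) — the textbook
direction "finite Möbius covariance ⇒ weak special-conformal Ward identities" is a theorem for every family that is continuous off the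
diagonals (`sctWardWeak_of_moebius`: translations and the unit inversion suffice; rotations and dilations are not used).  Consequences:

* `sctWardWeak_of_isMoebiusCovariant` — the first forward API of `Literature.Probability.LatticeModels.SCTWardWeak` (listed under
  'Not here' in `Literature/Probability/LatticeModels/SCTWardIdentity.lean`), for `d = 3`;
* **item 1982 ⟺ the bare Ward upgrade** (`inversionUpgradeNormalised_iff_wardUpgrade`, registered anchor): every normalised
  non-degenerate Euclidean scale-covariant pointwise limit of `criticalCorr 3` is inversion covariant IFF every such limit satisfies
  `∀ n, SCTWardWeak S Δ n`;
* **crux ⟺ 1981 ∧ 7″** (`MoebiusLimitExists_iff_existence_and_wardStrict`, and the PlantedPinning / SubPtolemyInterlacing /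
  EnergyNotSigmaSquared spellings): the residual of crux 1344 in WARD FORM on the interacting open-window stratum with the OS and
  clustering premises free — so the census of equivalent residuals reads `crux ⟺ 1981 ∧ X`, X ∈ {1982, 7′, 7″, 4840, 4671}.

References: Di Francesco–Mathieu–Sénéchal 1997 §4.1 (4.14)–(4.19), §4.3.1 (4.51)–(4.54) [FrancescoMathieuSenechal1997]; Lüscher–Mack 1975
[LuscherMack1975].  No definitions, no `sorry`.
-/

noncomputable section

namespace Summit.CriticalPhenomena.Ising3DConformalLimit.MoebiusLimitExistsWardDoor

open Filter Topology MeasureTheory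
open Literature.Probability.LatticeModels Literature.MathematicalPhysics.QuantumFieldTheory
open Summit.CriticalPhenomena.Ising3DConformalLimit.Theses
open Summit.CriticalPhenomena.Ising3DConformalLimit.MoebiusLimitExistsSketchV9
  (stub_weakTranslation stub_wardOnU0 stub_wardOfWardOnU0)
open Summit.CriticalPhenomena.Ising3DConformalLimit.MoebiusLimitExistsOnlyInteraction
  (existsScaleCovariantLimit_of_MoebiusLimitExists inversionUpgradeNormalised_of_MoebiusLimitExists)

/-! ## Finite covariance ⇒ weak special-conformal Ward identities -/

/-- **Translation invariance + unit-inversion covariance + continuity off the diagonals ⇒ the weak special-conformal Ward identities**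
(composition F2 ∘ F1 ∘ F0 of the landed analysis stubs of skeleton v9). [cite: FrancescoMathieuSenechal1997, §4.3.1 (4.51)–(4.54)] -/
theorem sctWardWeak_of_moebius {Δ : ℝ} {S : CorrFamily 3} (hcont : ∀ n, ContinuousOn (S n) (NonCoincident 3 n))
    (htr : IsTranslationInvariant S) (hinv : IsInversionCovariant Δ S) : ∀ n, SCTWardWeak S Δ n :=
  fun n => (sctWardWeak_three_iff S Δ n).2
    (stub_wardOfWardOnU0 n (S n) Δ (hcont n) (htr n)
      (stub_wardOnU0 n (S n) Δ (hcont n) (hinv n) (stub_weakTranslation n (S n) (hcont n) (htr n))))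

/-- **A Möbius-covariant family continuous off the diagonals satisfies the weak special-conformal Ward identities** (`d = 3`).
[cite: FrancescoMathieuSenechal1997, §4.3.1 (4.51)–(4.54)] -/
theorem sctWardWeak_of_isMoebiusCovariant {Δ : ℝ} {S : CorrFamily 3} (hcont : ∀ n, ContinuousOn (S n) (NonCoincident 3 n))
    (hM : IsMoebiusCovariant Δ S) : ∀ n, SCTWardWeak S Δ n :=
  sctWardWeak_of_moebius hcont hM.isEuclideanInvariant.1 hM.isInversionCovariant

/-- **For normalised Euclidean-invariant pointwise limits, Ward ⟺ Möbius** (door + converse; continuity is free).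
[cite: LuscherMack1975, Thm 1] -/
theorem sctWardWeak_iff_isMoebiusCovariant_of_limit {ρ : ℝ → ℝ} {Δ : ℝ} {S : CorrFamily 3}
    (hlim : HasPointwiseScalingLimit (criticalCorr 3) ρ S) (hnorm : ∀ n z, z ∉ NonCoincident 3 n → S n z = 0)
    (heuc : IsEuclideanInvariant S) : (∀ n, SCTWardWeak S Δ n) ↔ IsMoebiusCovariant Δ S :=
  ⟨isMoebiusCovariant_of_limit_of_sctWardWeak hlim hnorm heuc,
    sctWardWeak_of_isMoebiusCovariant (continuousOn_of_limit hlim)⟩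

/-! ## Item 1982 ⟺ the Ward upgrade -/

/-- **Item 1982 ⟺ the bare Ward upgrade** (registered anchor of this file): every normalised non-degenerate Euclidean scale-covariant
pointwise limit of the critical `ℤ³` correlators is inversion covariant iff every such limit satisfies the weak special-conformal Ward
identities. [cite: FrancescoMathieuSenechal1997, §4.3.1 eq. (4.62)] -/
theorem inversionUpgradeNormalised_iff_wardUpgrade : Summit.CriticalPhenomena.Ising3DConformalLimit.Theses.HyperoctahedralRP.InversionUpgradeNormalised ↔ (∀ (ρ : ℝ → ℝ) (Δ : ℝ) (S : Literature.Probability.LatticeModels.CorrFamily 3), (∀ δ ∈ Set.Ioc (0:ℝ) 1, 0 < ρ δ) → Literature.Probability.LatticeModels.HasPointwiseScalingLimit (Literature.Probability.LatticeModels.criticalCorr 3) ρ S → (∀ n z, z ∉ Literature.Probability.LatticeModels.NonCoincident 3 n → S n z = 0) → Literature.Probability.LatticeModels.IsNondegenerateTwoPoint S → Literature.Probability.LatticeModels.IsEuclideanInvariant S → Literature.Probability.LatticeModels.IsScaleCovariant Δ S → ∀ n, Literature.Probability.LatticeModels.SCTWardWeak S Δ n) :=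
  ⟨fun h _ Δ S hρ hlim hnorm hnd heuc hsc =>
      sctWardWeak_of_moebius (continuousOn_of_limit hlim) heuc.1 (h _ Δ S hρ hlim hnorm hnd heuc hsc),
    inversionUpgradeNormalised_of_wardUpgrade⟩

/-- **Item 1982 ⇒ 7″** (the Ward-form stub of skeleton v9, with its idle window / `U₄` / OS / clustering hypotheses).
[cite: FrancescoMathieuSenechal1997, §4.3.1 eq. (4.62)] -/
theorem wardStrict_of_inversionUpgradeNormalised (h : HyperoctahedralRP.InversionUpgradeNormalised) :
    ∀ (ρ : ℝ → ℝ) (Δ : ℝ) (S : CorrFamily 3), (∀ δ ∈ Set.Ioc (0:ℝ) 1, 0 < ρ δ) →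
      HasPointwiseScalingLimit (criticalCorr 3) ρ S → (∀ n z, z ∉ NonCoincident 3 n → S n z = 0) →
      IsNondegenerateTwoPoint S → IsEuclideanInvariant S → IsScaleCovariant Δ S →
      1 / 2 < Δ → Δ ≤ 3 / 4 → HasNontrivialU4 S →
      (∀ τ : Fin 3, PointwiseOSReconstruction τ S) →
      (∀ (n m : ℕ) (x : Fin n → EuclideanSpace ℝ (Fin 3)) (y : Fin m → EuclideanSpace ℝ (Fin 3))
        (v : EuclideanSpace ℝ (Fin 3)), v ≠ 0 →
        Tendsto (fun t : ℝ => S (n + m) (Fin.append x (fun j => y j + t • v)) - S n x * S m y)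
          atTop (𝓝 0)) →
      ∀ n, SCTWardWeak S Δ n :=
  fun ρ Δ S hρ hlim hnorm hnd heuc hsc _ _ _ _ _ =>
    sctWardWeak_of_moebius (continuousOn_of_limit hlim) heuc.1 (h ρ Δ S hρ hlim hnorm hnd heuc hsc)

/-- **Item 1982 ⟺ 7″.** [cite: FrancescoMathieuSenechal1997, §4.3.1 eq. (4.62)] -/
theorem inversionUpgradeNormalised_iff_wardStrict :
    HyperoctahedralRP.InversionUpgradeNormalised ↔
      (∀ (ρ : ℝ → ℝ) (Δ : ℝ) (S : CorrFamily 3), (∀ δ ∈ Set.Ioc (0:ℝ) 1, 0 < ρ δ) →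
        HasPointwiseScalingLimit (criticalCorr 3) ρ S → (∀ n z, z ∉ NonCoincident 3 n → S n z = 0) →
        IsNondegenerateTwoPoint S → IsEuclideanInvariant S → IsScaleCovariant Δ S →
        1 / 2 < Δ → Δ ≤ 3 / 4 → HasNontrivialU4 S →
        (∀ τ : Fin 3, PointwiseOSReconstruction τ S) →
        (∀ (n m : ℕ) (x : Fin n → EuclideanSpace ℝ (Fin 3)) (y : Fin m → EuclideanSpace ℝ (Fin 3))
          (v : EuclideanSpace ℝ (Fin 3)), v ≠ 0 →
          Tendsto (fun t : ℝ => S (n + m) (Fin.append x (fun j => y j + t • v)) - S n x * S m y)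
            atTop (𝓝 0)) →
        ∀ n, SCTWardWeak S Δ n) :=
  ⟨wardStrict_of_inversionUpgradeNormalised, inversionUpgradeNormalised_of_wardStrict⟩

/-! ## The crux ⟺ item 1981 ∧ 7″ -/

/-- **The crux implies 7″** (crux ⇒ 1982, p114842, then the converse door). [cite: FrancescoMathieuSenechal1997, §4.3.1 eq. (4.56)] -/
theorem wardStrict_of_MoebiusLimitExists (h : PerfectScreening.MoebiusLimitExists) :
    ∀ (ρ : ℝ → ℝ) (Δ : ℝ) (S : CorrFamily 3), (∀ δ ∈ Set.Ioc (0:ℝ) 1, 0 < ρ δ) →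
      HasPointwiseScalingLimit (criticalCorr 3) ρ S → (∀ n z, z ∉ NonCoincident 3 n → S n z = 0) →
      IsNondegenerateTwoPoint S → IsEuclideanInvariant S → IsScaleCovariant Δ S →
      1 / 2 < Δ → Δ ≤ 3 / 4 → HasNontrivialU4 S →
      (∀ τ : Fin 3, PointwiseOSReconstruction τ S) →
      (∀ (n m : ℕ) (x : Fin n → EuclideanSpace ℝ (Fin 3)) (y : Fin m → EuclideanSpace ℝ (Fin 3))
        (v : EuclideanSpace ℝ (Fin 3)), v ≠ 0 →
        Tendsto (fun t : ℝ => S (n + m) (Fin.append x (fun j => y j + t • v)) - S n x * S m y)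
          atTop (𝓝 0)) →
      ∀ n, SCTWardWeak S Δ n :=
  wardStrict_of_inversionUpgradeNormalised (inversionUpgradeNormalised_of_MoebiusLimitExists h)

/-- **TIGHTNESS of skeleton v9/v10: `MoebiusLimitExists ⟺ ExistsScaleCovariantLimit (1981) ∧ 7″`.** [cite: DuminilCopinICM2022, §8.4] -/
theorem MoebiusLimitExists_iff_existence_and_wardStrict :
    PerfectScreening.MoebiusLimitExists ↔
      HyperoctahedralRP.ExistsScaleCovariantLimit ∧
      (∀ (ρ : ℝ → ℝ) (Δ : ℝ) (S : CorrFamily 3), (∀ δ ∈ Set.Ioc (0:ℝ) 1, 0 < ρ δ) →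
        HasPointwiseScalingLimit (criticalCorr 3) ρ S → (∀ n z, z ∉ NonCoincident 3 n → S n z = 0) →
        IsNondegenerateTwoPoint S → IsEuclideanInvariant S → IsScaleCovariant Δ S →
        1 / 2 < Δ → Δ ≤ 3 / 4 → HasNontrivialU4 S →
        (∀ τ : Fin 3, PointwiseOSReconstruction τ S) →
        (∀ (n m : ℕ) (x : Fin n → EuclideanSpace ℝ (Fin 3)) (y : Fin m → EuclideanSpace ℝ (Fin 3))
          (v : EuclideanSpace ℝ (Fin 3)), v ≠ 0 →
          Tendsto (fun t : ℝ => S (n + m) (Fin.append x (fun j => y j + t • v)) - S n x * S m y)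
            atTop (𝓝 0)) →
        ∀ n, SCTWardWeak S Δ n) :=
  ⟨fun h => ⟨existsScaleCovariantLimit_of_MoebiusLimitExists h, wardStrict_of_MoebiusLimitExists h⟩,
    fun h => MoebiusLimitExists_of_existence_of_wardStrict h.1 h.2⟩

/-- **The crux ⟺ 1981 ∧ the bare Ward upgrade.** [cite: DuminilCopinICM2022, §8.4] -/
theorem MoebiusLimitExists_iff_existence_and_wardUpgrade :
    PerfectScreening.MoebiusLimitExists ↔
      HyperoctahedralRP.ExistsScaleCovariantLimit ∧
      (∀ (ρ : ℝ → ℝ) (Δ : ℝ) (S : CorrFamily 3), (∀ δ ∈ Set.Ioc (0:ℝ) 1, 0 < ρ δ) →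
        HasPointwiseScalingLimit (criticalCorr 3) ρ S → (∀ n z, z ∉ NonCoincident 3 n → S n z = 0) →
        IsNondegenerateTwoPoint S → IsEuclideanInvariant S → IsScaleCovariant Δ S → ∀ n, SCTWardWeak S Δ n) := by
  rw [← inversionUpgradeNormalised_iff_wardUpgrade]
  exact MoebiusLimitExistsTwoLeaf.MoebiusLimitExists_iff_leaves

/-- Route PlantedPinning's spelling of the tightness statement (byte-identical definiens). [cite: DuminilCopinICM2022, §8.4] -/
theorem plantedPinning_MoebiusLimitExists_iff_existence_and_wardStrict :
    PlantedPinning.MoebiusLimitExists ↔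
      HyperoctahedralRP.ExistsScaleCovariantLimit ∧
      (∀ (ρ : ℝ → ℝ) (Δ : ℝ) (S : CorrFamily 3), (∀ δ ∈ Set.Ioc (0:ℝ) 1, 0 < ρ δ) →
        HasPointwiseScalingLimit (criticalCorr 3) ρ S → (∀ n z, z ∉ NonCoincident 3 n → S n z = 0) →
        IsNondegenerateTwoPoint S → IsEuclideanInvariant S → IsScaleCovariant Δ S →
        1 / 2 < Δ → Δ ≤ 3 / 4 → HasNontrivialU4 S →
        (∀ τ : Fin 3, PointwiseOSReconstruction τ S) →
        (∀ (n m : ℕ) (x : Fin n → EuclideanSpace ℝ (Fin 3)) (y : Fin m → EuclideanSpace ℝ (Fin 3))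
          (v : EuclideanSpace ℝ (Fin 3)), v ≠ 0 →
          Tendsto (fun t : ℝ => S (n + m) (Fin.append x (fun j => y j + t • v)) - S n x * S m y)
            atTop (𝓝 0)) →
        ∀ n, SCTWardWeak S Δ n) :=
  MoebiusLimitExists_iff_existence_and_wardStrict

/-- Route SubPtolemyInterlacing's spelling of the tightness statement (decl `MoebiusLimit`). [cite: DuminilCopinICM2022, §8.4] -/
theorem subPtolemyInterlacing_MoebiusLimit_iff_existence_and_wardStrict :
    SubPtolemyInterlacing.MoebiusLimit ↔
      HyperoctahedralRP.ExistsScaleCovariantLimit ∧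
      (∀ (ρ : ℝ → ℝ) (Δ : ℝ) (S : CorrFamily 3), (∀ δ ∈ Set.Ioc (0:ℝ) 1, 0 < ρ δ) →
        HasPointwiseScalingLimit (criticalCorr 3) ρ S → (∀ n z, z ∉ NonCoincident 3 n → S n z = 0) →
        IsNondegenerateTwoPoint S → IsEuclideanInvariant S → IsScaleCovariant Δ S →
        1 / 2 < Δ → Δ ≤ 3 / 4 → HasNontrivialU4 S →
        (∀ τ : Fin 3, PointwiseOSReconstruction τ S) →
        (∀ (n m : ℕ) (x : Fin n → EuclideanSpace ℝ (Fin 3)) (y : Fin m → EuclideanSpace ℝ (Fin 3))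
          (v : EuclideanSpace ℝ (Fin 3)), v ≠ 0 →
          Tendsto (fun t : ℝ => S (n + m) (Fin.append x (fun j => y j + t • v)) - S n x * S m y)
            atTop (𝓝 0)) →
        ∀ n, SCTWardWeak S Δ n) :=
  MoebiusLimitExists_iff_existence_and_wardStrict

/-- Route EnergyNotSigmaSquared's spelling of the tightness statement (primary host route, decl `MoebiusLimit`).
[cite: DuminilCopinICM2022, §8.4] -/
theorem energyNotSigmaSquared_MoebiusLimit_iff_existence_and_wardStrict :
    EnergyNotSigmaSquared.MoebiusLimit ↔
      HyperoctahedralRP.ExistsScaleCovariantLimit ∧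
      (∀ (ρ : ℝ → ℝ) (Δ : ℝ) (S : CorrFamily 3), (∀ δ ∈ Set.Ioc (0:ℝ) 1, 0 < ρ δ) →
        HasPointwiseScalingLimit (criticalCorr 3) ρ S → (∀ n z, z ∉ NonCoincident 3 n → S n z = 0) →
        IsNondegenerateTwoPoint S → IsEuclideanInvariant S → IsScaleCovariant Δ S →
        1 / 2 < Δ → Δ ≤ 3 / 4 → HasNontrivialU4 S →
        (∀ τ : Fin 3, PointwiseOSReconstruction τ S) →
        (∀ (n m : ℕ) (x : Fin n → EuclideanSpace ℝ (Fin 3)) (y : Fin m → EuclideanSpace ℝ (Fin 3))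
          (v : EuclideanSpace ℝ (Fin 3)), v ≠ 0 →
          Tendsto (fun t : ℝ => S (n + m) (Fin.append x (fun j => y j + t • v)) - S n x * S m y)
            atTop (𝓝 0)) →
        ∀ n, SCTWardWeak S Δ n) :=
  MoebiusLimitExists_iff_existence_and_wardStrict

end Summit.CriticalPhenomena.Ising3DConformalLimit.MoebiusLimitExistsWardDoor

end
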